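import Literature.NumberTheory.Transcendental.KaehlerHodgeSmoothProofs
import Literature.NumberTheory.Transcendental.DolbeaultIntegrabilityProofs
import HarnessLib

/-!
# `d* = ∂* + ∂̄*`: the corrected statement of the named fact
`cmcoderiv_eq_dolbeaultAdjoint_add_dolbeaultBarAdjoint`

Trunk **T-KAEHLER** (`NumberTheory/Transcendental`). This file serves the named fact
`Literature.NumberTheory.Transcendental.cmcoderiv_eq_dolbeaultAdjoint_add_dolbeaultBarAdjoint` of
`Literature/NumberTheory/Transcendental/KaehlerHodge.lean` (§*Generic smoothness statements*:
"**`d* = ∂* + ∂̄*`** on smooth forms of a complex manifold with a smooth metric"), which is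
**mis-stated** — its hypotheses on the atlas and on the metric were lost at declaration time, see
below — and therefore cannot be discharged as declared. Following the rule for mis-stated facts
(never edit a fact's meaning in place; re-vendor under a new name) and the format of the sibling
corrected facts
`Literature.NumberTheory.Transcendental.isSmoothForm_cHodgeStar_of_isContMDiffRiemannianBundle`
(`KaehlerHodgeSmoothProofs.lean`, for `isSmoothForm_cHodgeStar` of the same section),
`Literature.Geometry.Kaehler.isSmoothForm_hodgeStar_of_isContMDiffRiemannianBundle`
(`RiemannianHodgeSmoothProofs.lean`) and
`Literature.Geometry.Kaehler.mcoderiv_mcoderiv_of_isContMDiffRiemannianBundle`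
(`RiemannianHodgeCodiffFact.lean`), it vendors the **corrected statement** as a *closed* named
fact, `cmcoderiv_eq_dolbeaultAdjoint_add_dolbeaultBarAdjoint_of_isContMDiffRiemannianBundle`, and
discharges it (`…_holds`). The statement in its intended setting is already a theorem of the
tree: `Literature.NumberTheory.Transcendental.cmcoderiv_eq_dolbeaultAdjoint_add_dolbeaultBarAdjoint'`
(`KaehlerHodgeLaplacianDProofs.lean`: `δα = ∂*α + ∂̄*α` for a smooth complex form `α` on a complex
manifold — holomorphic atlas `[IsManifold 𝓘(ℂ, E) ω M] [IsManifold 𝓘(ℝ, E) ∞ M]` — with a `C^∞`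
Riemannian metric on the real tangent bundle
`[IsContMDiffRiemannianBundle 𝓘(ℝ, E) ∞ E (TangentSpace 𝓘(ℝ, E))]` and an orientation family `o`
with smooth volume form), together with the bridge
`cmcoderiv_eq_dolbeaultAdjoint_add_dolbeaultBarAdjoint_of_contMDiffMetric` (the fact *as
declared*, in any context that carries the intended instances — which is how a dependent taking
`(h : cmcoderiv_eq_dolbeaultAdjoint_add_dolbeaultBarAdjoint o)` is to be fed). The discharge below
repeats that three-line computation from its two inputs (`IsSmoothForm.cHodgeStar`,
`KaehlerHodgeSmoothProofs.lean`; `mextDeriv_eq_dolbeault_add_dolbeaultBar_holds`,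
`DolbeaultIntegrabilityProofs.lean`) so that this fact file imports only those.

## Source

D. Huybrechts, *Complex Geometry. An Introduction* (Universitext, Springer 2005), §3.1: on an
oriented Riemannian manifold of even dimension `d* = -* ∘ d ∘ *` (display before Def. 3.1.3);
**Definition 3.1.3** "If `(X, g)` is an hermitian manifold, then `∂* := -* ∘ ∂̄ ∘ *` and
`∂̄* = -* ∘ ∂ ∘ *`"; **Lemma 3.1.4** "If `(X, g)` is an hermitian manifold then `d* = ∂* + ∂̄*` and
`∂*² = ∂̄*² = 0`", introduced by "The following lemma is an immediate consequence of the
decomposition `d = ∂ + ∂̄` which holds because the almost complex structure on a complex manifold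
is integrable (Proposition 2.6.15)", and, at the start of §3.1, "as soon as we use the splitting
of the exterior differential `d = ∂ + ∂̄`, we need an integrable almost complex structure". (The
docstring of the original fact cites Lemma 3.2.3, which is the `L²`-adjointness of `∂*`, `∂̄*` on a
*compact* hermitian manifold; the identity `d* = ∂* + ∂̄*` itself is Lemma 3.1.4.) Also
Griffiths–Harris (1978), p. 82.

## Why `cmcoderiv_eq_dolbeaultAdjoint_add_dolbeaultBarAdjoint` is mis-stated

`KaehlerHodge.lean` declares the fact inside `section Smooth`, under the section variables
`[IsManifold 𝓘(ℂ, E) ω M] [IsManifold 𝓘(ℝ, E) ∞ M] [IsContinuousRiemannianBundle E …]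
[IsContMDiffRiemannianBundle 𝓘(ℝ, E) ∞ E …]`, and its docstring says "on smooth forms of a complex
manifold with a smooth metric"; but a `def … : Prop` abstracts only the section variables its
body *uses*, and the body uses none of these four. The elaborated constant
(`#check @cmcoderiv_eq_dolbeaultAdjoint_add_dolbeaultBarAdjoint`) quantifies only over
`[ChartedSpace E M] [FiniteDimensional ℂ E] [Fact (finrank ℝ E = n)]
[RiemannianBundle (fun x ↦ TangentSpace 𝓘(ℝ, E) x)]` and the orientation family `o`: its universal
closure asserts `δα = ∂*α + ∂̄*α` for every smooth form on an *arbitrary charted space* over `E`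
(no compatibility of the charts, let alone holomorphic transition maps) with an *arbitrary
fibrewise* inner product (`Bundle.RiemannianBundle` carries no regularity in the base point). This
is not Huybrechts' statement (an hermitian manifold is a complex manifold with a smooth compatible
metric), and it is false in that generality. Unfolding `δ = -⋆d⋆`, `∂* = -⋆∂̄⋆`, `∂̄* = -⋆∂⋆`
(`cmcoderiv_eq_neg`, `dolbeaultAdjoint`, `dolbeaultBarAdjoint`) and cancelling the pointwise
injective `⋆`, the identity says exactly `d(⋆α) = ∂(⋆α) + ∂̄(⋆α)`, i.e. the splitting `d = ∂ + ∂̄`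
(`mextDeriv_eq_dolbeault_add_dolbeaultBar`) applied to `⋆α` — which needs (i) the integrability of
the almost complex structure, here the holomorphic atlas (`DolbeaultIntegrabilityProofs.lean`), and
(ii) smoothness of `⋆α`, false for a discontinuous fibrewise metric (the `ℝ²` example
`g = diag(λ, λ⁻¹)`, `⋆dx = λ⁻¹dy` recorded at `isSmoothForm_hodgeStar_of_isContMDiffRiemannianBundle`
and at `isSmoothForm_cHodgeStar_of_isContMDiffRiemannianBundle`; `mextDeriv` of a non-smooth form is
a junk value). Counterexample to the declared statement (not formalised here; the same two-chart
atlas refutes `cHodgeLaplacian_eq_two_smul_dolbeaultLaplacian`, see `KaehlerHodge.lean`, module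
docstring, *Correction*): `E = ℂ`, `M = ℂ` with the two global charts `id` (the preferred chart at
the points `Re z < 0`) and `z ↦ z̄` (preferred at `Re z ≥ 0`) — a `C^∞` but not holomorphic atlas
—, the flat fibrewise metric, and the orientation family which is the standard one of `ℂ ≅ ℝ²` at
`Re z < 0` and the reversed one at `Re z ≥ 0` (so that `riemannianVolumeForm o` is smooth, its
chart representatives being constant). For the smooth `1`-form `α = x dx` (`x = Re z`) one finds
`⋆α = -|x| dy` as a family of alternating maps on `E`, which *is* smooth for this atlas (its
representative in the chart `z ↦ z̄` at a seam point is `-x dy`), with `d(⋆α) = -dx ∧ dy ≠ 0` at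
the seam points `Re z = 0`; but the pointwise type components `(⋆α)^{1,0} = -|x| dz/2i`,
`(⋆α)^{0,1} = |x| dz̄/2i` have chart representatives with different one-sided derivatives across
the seam (`-dz/2i` against `dz̄/2i`), so `mextDeriv` assigns them the junk value `0` there, whence
`∂(⋆α) = ∂̄(⋆α) = 0` and `∂*α + ∂̄*α = 0 ≠ δα` at every seam point. The sibling facts of the
same section drop the same instances (`isSmoothForm_cHodgeStar` is corrected in
`KaehlerHodgeSmoothProofs.lean`; `isSmoothForm_dolbeaultBarAdjoint`, `isSmoothForm_dolbeaultAdjoint`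
have the same defect, their usable forms being `IsSmoothForm.dolbeaultBarAdjoint`,
`IsSmoothForm.dolbeaultAdjoint` of `KaehlerHodgeLaplacianDProofs.lean`). The original `def` is left
untouched; it has no dependents.

## Proof (Huybrechts, proof of Lemma 3.1.4: "immediate consequence of `d = ∂ + ∂̄`")

For `α` smooth, `⋆α = (⋆ Re α) ⊗ 1 + i (⋆ Im α) ⊗ 1` is smooth by Warner's 4.10 (6)
(`IsSmoothForm.cHodgeStar`, `KaehlerHodgeSmoothProofs.lean`), so `d(⋆α) = ∂(⋆α) + ∂̄(⋆α)`
(`mextDeriv_eq_dolbeault_add_dolbeaultBar_holds`, `DolbeaultIntegrabilityProofs.lean`), and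
applying the `ℂ`-linear `-⋆` gives `δα = -⋆d⋆α = -⋆∂̄⋆α - ⋆∂⋆α = ∂*α + ∂̄*α` (`cmcoderiv_eq_neg`:
the real dimension is even) — this is `cmcoderiv_eq_dolbeaultAdjoint_add_dolbeaultBarAdjoint'` of
`KaehlerHodgeLaplacianDProofs.lean`, the interim proof preserved (commented) under the fact in
`KaehlerHodge.lean` with its two inputs now theorems.

## References

* D. Huybrechts, *Complex Geometry. An Introduction*, Universitext, Springer (2005), §3.1,
  Def. 3.1.3 and Lemma 3.1.4; Prop. 2.6.15 (`d = ∂ + ∂̄`); Lemma 3.2.3 (formal adjoints).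
  [Huybrechts2005]
* P. Griffiths, J. Harris, *Principles of Algebraic Geometry* (1978), p. 82.
* F. W. Warner, *Foundations of Differentiable Manifolds and Lie Groups*, GTM 94 (1983), 4.10 (6),
  p. 150 (`*` maps smooth forms to smooth forms); 6.1, p. 220.
-/

noncomputable section

open scoped Manifold ContDiff
open Bundle Module

namespace Literature.NumberTheory.Transcendental

open Literature.Geometry.Kaehler (MForm IsSmoothForm riemannianVolumeForm)

/-- **`d* = ∂* + ∂̄*` — corrected statement of the named fact
`Literature.NumberTheory.Transcendental.cmcoderiv_eq_dolbeaultAdjoint_add_dolbeaultBarAdjoint`**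
(`KaehlerHodge.lean`). On a complex manifold `M` modelled on the finite-dimensional complex normed
space `E` (holomorphic atlas, `[IsManifold 𝓘(ℂ, E) ω M] [IsManifold 𝓘(ℝ, E) ∞ M]`) with a `C^∞`
Riemannian metric on the real tangent bundle
(`[IsContMDiffRiemannianBundle 𝓘(ℝ, E) ∞ E (fun x : M ↦ TangentSpace 𝓘(ℝ, E) x)]`) and an
orientation family `o` with smooth volume form, the complexified codifferential `δ = -⋆d⋆`
(`cmcoderiv`) of every smooth complex form `α` of degree `k + 1` splits as
`δα = ∂*α + ∂̄*α` with `∂* = -⋆∂̄⋆` (`dolbeaultAdjoint`) and `∂̄* = -⋆∂⋆` (`dolbeaultBarAdjoint`).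
Huybrechts, *Complex Geometry* (2005), §3.1, Lemma 3.1.4: "If `(X, g)` is an hermitian manifold
then `d* = ∂* + ∂̄*` and `∂*² = ∂̄*² = 0`" (with Def. 3.1.3 for `∂*`, `∂̄*` and the display
`d* = -* ∘ d ∘ *` before it); Griffiths–Harris (1978), p. 82. The hermitian compatibility of `g`
is not needed for this identity (nor used in the printed proof, "an immediate consequence of the
decomposition `d = ∂ + ∂̄`").

Discrepancy with the original: `def cmcoderiv_eq_dolbeaultAdjoint_add_dolbeaultBarAdjoint` is
declared in a section whose instance variables `[IsManifold 𝓘(ℂ, E) ω M]`,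
`[IsManifold 𝓘(ℝ, E) ∞ M]`, `[IsContinuousRiemannianBundle E …]`,
`[IsContMDiffRiemannianBundle 𝓘(ℝ, E) ∞ E …]` are *not used in its body*, hence are not part of
the definition: as declared it asserts `δ = ∂* + ∂̄*` over arbitrary charted spaces over `E` and
arbitrary fibrewise (possibly discontinuous) metrics — stronger than the source ("as soon as we
use the splitting `d = ∂ + ∂̄`, we need an integrable almost complex structure", Huybrechts, §3.1),
false in that generality (module docstring), and not what is proved there
(`d(⋆α) = ∂(⋆α) + ∂̄(⋆α)` needs the holomorphic atlas and `⋆α` smooth). Here the hypotheses of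
Huybrechts' setting are bound *inside* a closed statement (`IsContinuousRiemannianBundle` is not
needed). Discharged by
`cmcoderiv_eq_dolbeaultAdjoint_add_dolbeaultBarAdjoint_of_isContMDiffRiemannianBundle_holds`; the
usable forms are the theorem `cmcoderiv_eq_dolbeaultAdjoint_add_dolbeaultBarAdjoint'` and the
bridge `cmcoderiv_eq_dolbeaultAdjoint_add_dolbeaultBarAdjoint_of_contMDiffMetric`
(`KaehlerHodgeLaplacianDProofs.lean`). [cite: Huybrechts2005, §3.1, Lemma 3.1.4] -/
def cmcoderiv_eq_dolbeaultAdjoint_add_dolbeaultBarAdjoint_of_isContMDiffRiemannianBundle : Prop :=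
  ∀ {E : Type*} [NormedAddCommGroup E] [NormedSpace ℂ E] [FiniteDimensional ℂ E] {n : ℕ}
    [Fact (finrank ℝ E = n)] {M : Type*} [TopologicalSpace M] [ChartedSpace E M]
    [IsManifold 𝓘(ℂ, E) ω M] [IsManifold 𝓘(ℝ, E) ∞ M]
    [RiemannianBundle (fun x : M ↦ TangentSpace 𝓘(ℝ, E) x)]
    [IsContMDiffRiemannianBundle 𝓘(ℝ, E) ∞ E (fun x : M ↦ TangentSpace 𝓘(ℝ, E) x)] {k m : ℕ}
    (o : (x : M) → Orientation ℝ (TangentSpace 𝓘(ℝ, E) x) (Fin n)),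
    IsSmoothForm (riemannianVolumeForm o) → ∀ (h : (k + 1) + m = n)
      {α : MForm 𝓘(ℝ, E) M ℂ (k + 1)}, IsSmoothForm α →
        cmcoderiv o h α = dolbeaultAdjoint o h α + dolbeaultBarAdjoint o h α

/-- **Discharge of
`cmcoderiv_eq_dolbeaultAdjoint_add_dolbeaultBarAdjoint_of_isContMDiffRiemannianBundle`** (the
corrected form of the named fact `cmcoderiv_eq_dolbeaultAdjoint_add_dolbeaultBarAdjoint`,
`d* = ∂* + ∂̄*`), Huybrechts' proof of Lemma 3.1.4: `⋆α` is smooth (`IsSmoothForm.cHodgeStar`),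
so `d(⋆α) = ∂(⋆α) + ∂̄(⋆α)` (`mextDeriv_eq_dolbeault_add_dolbeaultBar_holds`), and `δ = -⋆d⋆`
(`cmcoderiv_eq_neg`, even real dimension), `∂* = -⋆∂̄⋆`, `∂̄* = -⋆∂⋆` with `⋆` `ℂ`-linear — the
same computation as `cmcoderiv_eq_dolbeaultAdjoint_add_dolbeaultBarAdjoint'` of
`KaehlerHodgeLaplacianDProofs.lean`. Huybrechts (2005), §3.1, Lemma 3.1.4.
[cite: Huybrechts2005, §3.1, Lemma 3.1.4] -/
theorem cmcoderiv_eq_dolbeaultAdjoint_add_dolbeaultBarAdjoint_of_isContMDiffRiemannianBundle_holds :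
    cmcoderiv_eq_dolbeaultAdjoint_add_dolbeaultBarAdjoint_of_isContMDiffRiemannianBundle :=
  fun o ho h _ hα ↦ by
    rw [cmcoderiv_eq_neg, mextDeriv_eq_dolbeault_add_dolbeaultBar_holds
      (IsSmoothForm.cHodgeStar o ho h hα), map_add, neg_add, dolbeaultAdjoint, dolbeaultBarAdjoint,
      add_comm]

end Literature.NumberTheory.Transcendental
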